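import Literature.Computability.QuantumComplexity.PolynomialMethod
import Literature.Computability.QuantumComplexity.ExactQuantumQuery
import Mathlib.Data.Matrix.Block
import Mathlib.Logic.Equiv.Set

/-!
# Re-indexing a quantum query algorithm along a map of input positions

Support lemma for the crux `WhiteBoxWalk.WbwVerifiableLineNoSpeedup` (stmt-QuantumAdvantage-2239),
from the refuter work file `Cruxes/WbwVerifiableLineNoSpeedup/Disproof.lean` (§5, §7.2): the
"bit-copy reduction" principle of query complexity, for the tree's model `QQueryAlg`
(`Literature/Computability/Cryptography/QuantumQuery.lean`).

For `src : Fin N₁ → Fin N₀` and `A : QQueryAlg N₁` we build `reindexAlg src A : QQueryAlg N₀` with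
the same number of queries and `acceptProb (reindexAlg src A) t = acceptProb A (t ∘ src)`
(`reindexAlg_acceptProb`): the basis `(i, b, w)` is embedded as `(src i, b, (w, i))`, the unitaries
are extended by the identity on the complement of the embedded basis, and the bit-flip oracle for
`t` restricts to the oracle for `t ∘ src` on the embedded basis. Consequence
(`quantumQueryComplexityOn_le_of_reindex`): if every instance `t ∈ D₀` of a problem `(D₀, f₀)` on
`N₀` bits yields an instance `t ∘ src ∈ D₁` of `(D₁, f₁)` with `f₁ (t ∘ src) = f₀ t`, then
`Q_ε(D₀, f₀) ≤ Q_ε(D₁, f₁)` (`0 ≤ ε`). Standard ("we may assume the input is presented …"); cf.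
Buhrman–de Wolf 2002 §3. Users: `Padding.lean` (padding monotonicity of black-box SVL) and
`GroverTight.lean` (the sink bit is an OR over half a column). Generic in nature — a librarian may
relocate it under `Literature/Computability/QuantumComplexity/`. Sorry-free.
-/

noncomputable section

set_option linter.dupNamespace false

namespace Summit.QuantumAdvantage.QuantumAdvantage.Theorems.WbwVerifiableLineNoSpeedup.Negative.QueryReindex

open Matrix Literature.Computability.Cryptography Literature.Computability.QuantumComplexity

/-! ### Extending unitaries along an injection of bases -/

section Extend

variable {β₁ β₀ : Type} (e : β₁ → β₀) (he : Function.Injective e)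

/-- The complement of the range of `e`. [folklore] -/
abbrev Cmp : Type := ↥(Set.range e)ᶜ

/-- The complement of the range is finite. [folklore] -/
instance instFintypeCmp [Finite β₀] : Fintype (Cmp e) := Fintype.ofFinite _

open Classical in
/-- `β₀ ≃ β₁ ⊕ (complement of the range)`, sending `e s` to `inl s`. [folklore] -/
def split : β₀ ≃ β₁ ⊕ Cmp e :=
  (Equiv.Set.sumCompl (Set.range e)).symm.trans
    (Equiv.sumCongr (Equiv.ofInjective e he).symm (Equiv.refl _))

/-- `split (e s) = inl s`. [folklore] -/
theorem split_apply_e (s : β₁) : split e he (e s) = Sum.inl s := by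
  classical
  unfold split
  rw [Equiv.trans_apply, Equiv.Set.sumCompl_symm_apply_of_mem (Set.mem_range_self s),
    Equiv.sumCongr_apply, Sum.map_inl]
  congr 1
  exact (Equiv.ofInjective e he).symm_apply_eq.2 rfl

/-- Off the range, `split` is the inclusion of the complement. [folklore] -/
theorem split_apply_of_not_mem {x : β₀} (hx : x ∉ Set.range e) :
    split e he x = Sum.inr ⟨x, hx⟩ := by
  classical
  unfold split
  rw [Equiv.trans_apply, Equiv.Set.sumCompl_symm_apply_of_notMem hx, Equiv.sumCongr_apply,
    Sum.map_inr]
  rfl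

/-- Push a vector on `β₁` forward to `β₀` (zero off the range). [folklore] -/
def lift (ψ : β₁ → ℂ) : β₀ → ℂ := fun x => Sum.elim ψ 0 (split e he x)

/-- `lift ψ (e s) = ψ s`. [folklore] -/
theorem lift_e (ψ : β₁ → ℂ) (s : β₁) : lift e he ψ (e s) = ψ s := by
  simp [lift, split_apply_e]

/-- `lift ψ` vanishes off the range. [folklore] -/
theorem lift_of_not_mem (ψ : β₁ → ℂ) {x : β₀} (hx : x ∉ Set.range e) : lift e he ψ x = 0 := by
  simp [lift, split_apply_of_not_mem e he hx]

/-- `lift ψ` read through `split⁻¹` is `ψ ⊕ 0`. [folklore] -/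
theorem lift_comp_symm (ψ : β₁ → ℂ) : lift e he ψ ∘ (split e he).symm = Sum.elim ψ 0 := by
  funext y
  simp [lift]

section DecEq

variable [DecidableEq β₁] [DecidableEq β₀]

/-- `lift` maps basis vectors to basis vectors. [folklore] -/
theorem lift_single (s : β₁) : lift e he (Pi.single s 1) = Pi.single (e s) 1 := by
  funext x
  by_cases hx : x ∈ Set.range e
  · obtain ⟨s', rfl⟩ := hx
    rw [lift_e]
    by_cases h : s' = s
    · subst h; simp
    · rw [Pi.single_eq_of_ne h, Pi.single_eq_of_ne (he.ne h)]
  · rw [lift_of_not_mem e he _ hx, Pi.single_eq_of_ne]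
    rintro rfl
    exact hx (Set.mem_range_self s)

end DecEq

section Mat

variable [Fintype β₁] [DecidableEq β₁] [Fintype β₀] [DecidableEq β₀]

/-- The block matrix `U ⊕ 1` transported to `β₀`. [folklore] -/
def extMatrix (U : Matrix β₁ β₁ ℂ) : Matrix β₀ β₀ ℂ :=
  Matrix.reindex (split e he).symm (split e he).symm (Matrix.fromBlocks U 0 0 (1 : Matrix (Cmp e) (Cmp e) ℂ))

omit [DecidableEq β₁] in
/-- `extMatrix U` acts on lifted vectors as `U`. [folklore] -/
theorem extMatrix_mulVec_lift (U : Matrix β₁ β₁ ℂ) (ψ : β₁ → ℂ) :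
    extMatrix e he U *ᵥ lift e he ψ = lift e he (U *ᵥ ψ) := by
  unfold extMatrix
  rw [Matrix.reindex_apply, Equiv.symm_symm, Matrix.submatrix_mulVec_equiv, lift_comp_symm,
    Matrix.fromBlocks_mulVec]
  funext x
  simp only [Function.comp_apply, lift, Sum.elim_comp_inl, Sum.elim_comp_inr, Matrix.mulVec_zero,
    add_zero, Matrix.zero_mulVec]

/-- `U ⊕ 1` is unitary when `U` is. [folklore] -/
theorem fromBlocks_diag_mem_unitaryGroup {U : Matrix β₁ β₁ ℂ} (hU : U ∈ Matrix.unitaryGroup β₁ ℂ) :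
    Matrix.fromBlocks U 0 0 (1 : Matrix (Cmp e) (Cmp e) ℂ) ∈
      Matrix.unitaryGroup (β₁ ⊕ Cmp e) ℂ := by
  rw [Matrix.mem_unitaryGroup_iff] at hU ⊢
  rw [Matrix.star_eq_conjTranspose, Matrix.fromBlocks_conjTranspose, Matrix.fromBlocks_multiply]
  simp only [Matrix.conjTranspose_zero, Matrix.conjTranspose_one, Matrix.mul_zero, Matrix.zero_mul,
    add_zero, zero_add, Matrix.mul_one]
  rw [← Matrix.star_eq_conjTranspose, hU, Matrix.fromBlocks_one]

/-- Reindexing along an equivalence preserves unitarity (cf. the tree's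
`HTCnotUniversalityDensityProofs.reindex_mem_unitaryGroup`, re-proved to keep imports light). [folklore] -/
theorem reindex_mem_unitaryGroup' {m n : Type} [Fintype m] [DecidableEq m] [Fintype n] [DecidableEq n]
    (f : m ≃ n) {M : Matrix m m ℂ} (hM : M ∈ Matrix.unitaryGroup m ℂ) :
    Matrix.reindex f f M ∈ Matrix.unitaryGroup n ℂ := by
  rw [Matrix.mem_unitaryGroup_iff] at hM ⊢
  rw [Matrix.reindex_apply, Matrix.star_eq_conjTranspose, Matrix.conjTranspose_submatrix,
    ← Matrix.star_eq_conjTranspose, Matrix.submatrix_mul_equiv, hM, Matrix.submatrix_one_equiv]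

/-- `extMatrix U` is unitary when `U` is. [folklore] -/
theorem extMatrix_mem_unitaryGroup {U : Matrix β₁ β₁ ℂ} (hU : U ∈ Matrix.unitaryGroup β₁ ℂ) :
    extMatrix e he U ∈ Matrix.unitaryGroup β₀ ℂ :=
  reindex_mem_unitaryGroup' _ (fromBlocks_diag_mem_unitaryGroup e hU)

/-- The extension as an element of the unitary group. [folklore] -/
def extU (U : Matrix.unitaryGroup β₁ ℂ) : Matrix.unitaryGroup β₀ ℂ :=
  ⟨extMatrix e he U, extMatrix_mem_unitaryGroup e he U.2⟩

end Mat

end Extend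

/-! ### The re-indexed algorithm -/

variable {N₀ N₁ : ℕ}

/-- The basis embedding `(i, b, w) ↦ (src i, b, (w, i))`. [folklore] -/
def emb (src : Fin N₁ → Fin N₀) (A : QQueryAlg N₁) (s : Fin N₁ × Bool × A.W) :
    Fin N₀ × Bool × (A.W × Fin N₁) :=
  (src s.1, s.2.1, (s.2.2, s.1))

/-- The basis embedding is injective (the original index is kept in the workspace). [folklore] -/
theorem emb_injective (src : Fin N₁ → Fin N₀) (A : QQueryAlg N₁) :
    Function.Injective (emb src A) := by
  rintro ⟨i, b, w⟩ ⟨i', b', w'⟩ h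
  simp only [emb, Prod.mk.injEq] at h
  obtain ⟨-, rfl, rfl, rfl⟩ := h
  rfl

/-- The oracle on `N₀` bits, restricted along `emb`, is the oracle on `N₁` bits for `t ∘ src`. [folklore] -/
theorem queryMap_emb (src : Fin N₁ → Fin N₀) (A : QQueryAlg N₁) (t : Fin N₀ → Bool)
    (s : Fin N₁ × Bool × A.W) :
    queryMap t (emb src A s) = emb src A (queryMap (t ∘ src) s) := rfl

/-- **The re-indexed algorithm**: same number of queries; unitaries extended by the identity off
the embedded basis (Buhrman–de Wolf 2002, §3: the model is invariant under re-presentation of the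
input). [folklore] -/
def reindexAlg (src : Fin N₁ → Fin N₀) (A : QQueryAlg N₁) : QQueryAlg N₀ where
  W := A.W × Fin N₁
  queries := A.queries
  unitaries := fun j => extU (emb src A) (emb_injective src A) (A.unitaries j)
  start := emb src A A.start
  accept := emb src A '' A.accept

/-- Same number of queries. [folklore] -/
theorem reindexAlg_queries (src : Fin N₁ → Fin N₀) (A : QQueryAlg N₁) :
    (reindexAlg src A).queries = A.queries := rfl

/-- The oracle commutes with `lift`. [folklore] -/
theorem queryOracle_mulVec_lift (src : Fin N₁ → Fin N₀) (A : QQueryAlg N₁) (t : Fin N₀ → Bool)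
    (ψ : Fin N₁ × Bool × A.W → ℂ) :
    queryOracle (W := A.W × Fin N₁) t *ᵥ lift (emb src A) (emb_injective src A) ψ =
      lift (emb src A) (emb_injective src A) (queryOracle (t ∘ src) *ᵥ ψ) := by
  funext x
  rw [queryOracle_mulVec_apply]
  change lift _ _ ψ (queryMap t x) = _
  by_cases hx : x ∈ Set.range (emb src A)
  · obtain ⟨s, rfl⟩ := hx
    rw [queryMap_emb, lift_e, lift_e, queryOracle_mulVec_apply]
    rfl
  · have hx' : queryMap t x ∉ Set.range (emb src A) := by
      rintro ⟨s, hs⟩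
      apply hx
      refine ⟨queryMap (t ∘ src) s, ?_⟩
      rw [← queryMap_emb, hs]
      exact queryMap_involutive t x
    rw [lift_of_not_mem _ _ _ hx, lift_of_not_mem _ _ _ hx']

/-- Two folds intertwined by a map agree. [folklore] -/
theorem foldl_map_comm {α₀ α₁ : Type*} (n : ℕ) (f₀ : α₀ → Fin n → α₀) (f₁ : α₁ → Fin n → α₁)
    (L : α₁ → α₀) (h : ∀ a j, L (f₁ a j) = f₀ (L a) j) (init : α₁) :
    Fin.foldl n f₀ (L init) = L (Fin.foldl n f₁ init) := by
  induction n generalizing init with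
  | zero => simp
  | succ n ih =>
    rw [Fin.foldl_succ, Fin.foldl_succ, ← h]
    exact ih (fun a j => f₀ a j.succ) (fun a j => f₁ a j.succ) (fun a j => h a j.succ) _

/-- The final state of the re-indexed algorithm is the lift of the original final state on
`t ∘ src`. [folklore] -/
theorem reindexAlg_finalState (src : Fin N₁ → Fin N₀) (A : QQueryAlg N₁) (t : Fin N₀ → Bool) :
    (reindexAlg src A).finalState t =
      lift (emb src A) (emb_injective src A) (A.finalState (t ∘ src)) := by
  unfold QQueryAlg.finalState
  have hinit : ((reindexAlg src A).unitaries 0).1 *ᵥ Pi.single (reindexAlg src A).start 1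
      = lift (emb src A) (emb_injective src A)
          ((A.unitaries 0).1 *ᵥ Pi.single A.start 1) := by
    rw [← extMatrix_mulVec_lift, lift_single]
    rfl
  rw [hinit]
  refine foldl_map_comm A.queries _ _ _ (fun ψ j => ?_) _
  rw [← extMatrix_mulVec_lift, ← queryOracle_mulVec_lift]
  rfl

/-- **Acceptance probabilities agree**: `P[reindexAlg src A accepts t] = P[A accepts t ∘ src]`. [folklore] -/
theorem reindexAlg_acceptProb (src : Fin N₁ → Fin N₀) (A : QQueryAlg N₁) (t : Fin N₀ → Bool) :
    (reindexAlg src A).acceptProb t = A.acceptProb (t ∘ src) := by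
  classical
  unfold QQueryAlg.acceptProb
  rw [reindexAlg_finalState]
  have hacc : (reindexAlg src A).accept = emb src A '' A.accept := rfl
  symm
  refine Finset.sum_nbij (emb src A) (fun s hs => ?_) (fun s _ s' _ h => emb_injective src A h)
    (fun x hx => ?_) (fun s _ => by rw [lift_e])
  · rw [Finset.mem_filter] at hs ⊢
    exact ⟨Finset.mem_univ _, hacc ▸ Set.mem_image_of_mem _ hs.2⟩
  · rw [Finset.mem_coe, Finset.mem_filter, hacc] at hx
    obtain ⟨s, hs, rfl⟩ := hx.2
    exact ⟨s, by rw [Finset.mem_coe, Finset.mem_filter]; exact ⟨Finset.mem_univ _, hs⟩, rfl⟩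

/-- If problem `(D₀, f₀)` on `N₀` bits is a bit-copy image of problem `(D₁, f₁)` on `N₁` bits
along `src`, then every algorithm for the latter yields one for the former with the same number
of queries and the same error. [folklore] -/
theorem computesWithError_reindexAlg {src : Fin N₁ → Fin N₀} {A : QQueryAlg N₁} {ε : ℝ}
    {D₀ : Set (Fin N₀ → Bool)} {f₀ : (Fin N₀ → Bool) → Bool}
    {D₁ : Set (Fin N₁ → Bool)} {f₁ : (Fin N₁ → Bool) → Bool}
    (hD : ∀ t ∈ D₀, t ∘ src ∈ D₁) (hf : ∀ t ∈ D₀, f₁ (t ∘ src) = f₀ t)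
    (hA : A.ComputesWithError ε D₁ f₁) : (reindexAlg src A).ComputesWithError ε D₀ f₀ := by
  intro t ht
  rw [reindexAlg_acceptProb, ← hf t ht]
  exact hA _ (hD t ht)

/-- **Monotonicity of quantum query complexity under bit-copy reductions** (`0 ≤ ε`):
`Q_ε(D₀, f₀) ≤ Q_ε(D₁, f₁)` whenever `t ↦ t ∘ src` maps `D₀` into `D₁` compatibly with `f₀, f₁`. [folklore] -/
theorem quantumQueryComplexityOn_le_of_reindex [NeZero N₁] {ε : ℝ} (hε : 0 ≤ ε)
    (src : Fin N₁ → Fin N₀)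
    {D₀ : Set (Fin N₀ → Bool)} {f₀ : (Fin N₀ → Bool) → Bool}
    {D₁ : Set (Fin N₁ → Bool)} {f₁ : (Fin N₁ → Bool) → Bool}
    (hD : ∀ t ∈ D₀, t ∘ src ∈ D₁) (hf : ∀ t ∈ D₀, f₁ (t ∘ src) = f₀ t) :
    quantumQueryComplexityOn ε D₀ f₀ ≤ quantumQueryComplexityOn ε D₁ f₁ := by
  obtain ⟨A, hAq, hA⟩ := exists_queries_eq_quantumQueryComplexityOn hε D₁ f₁
  rw [← hAq]
  exact Nat.sInf_le ⟨reindexAlg src A, rfl, computesWithError_reindexAlg hD hf hA⟩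

end Summit.QuantumAdvantage.QuantumAdvantage.Theorems.WbwVerifiableLineNoSpeedup.Negative.QueryReindex
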